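import Summits.AtomisticToContinuum.HydrodynamicLimit.Theses.TwoClocks
import Literature.Analysis.FluidPDE.HardSphereDynamicsProofs

/-!
# Certificate uniqueness for hard-sphere trajectories (helper file, refutation of
`EquilibriumClampedCollisionalWindowLD`, stmt-AtomisticToContinuum-13733, layer L1)

A hard-sphere trajectory (`IsHardSphereTrajectory`) is determined on a window `[0, T]` by any
*certificate* it starts from: a curve `γ'` which is free flight between finitely many jump times,
has no pair at distance exactly `ε` off the jump times, and at each jump time has a left limit with
a contact pair whose elastic reflection it takes — the last requirement only when that contact pair
is the unique one (so that products of independent certificates are certificates; simultaneous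
jumps are then excluded by the trajectory's own `binary` axiom).  This is the only dynamical input
(`HardSphereFlow.isTrajectory`) used by the Newton-cradle refutation of the crux, see
`Cruxes/EquilibriumClampedCollisionalWindowLD/Disproof.lean` and the item's evidence WITNESS.md §4.1.
The proof is the first-disagreement-time argument of `IsHardSphereTrajectory.unique_holds`.
refuter-cdisprove-stmt-AtomisticToContinuum-13733-0.
-/

noncomputable section

namespace Summit.AtomisticToContinuum.HydrodynamicLimit.Theorems

open Filter Topology Set
open Literature.Analysis.FluidPDE

namespace EquilibriumClampedCollisionalWindowLDNegative

section Certificate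

variable {d : Type*} [Fintype d] {X : Type*} [TopologicalSpace X] [T2Space X] {N : ℕ}
variable {G : Geometry d X} {ε T : ℝ} {γ γ' : ℝ → Config N d X}

/-- Off a finite set of reals there is room to the left: for `0 < τ` there is `s ∈ [0, τ)` with
`(s, τ) ∩ C = ∅`. [folklore] -/
theorem exists_left_gap {C : Set ℝ} (hC : C.Finite) {τ : ℝ} (hτ : 0 < τ) :
    ∃ s, 0 ≤ s ∧ s < τ ∧ ∀ c ∈ C, c ∉ Ioo s τ := by
  classical
  set F : Finset ℝ := insert 0 (hC.toFinset.filter fun c => c < τ) with hF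
  have hne : F.Nonempty := ⟨0, Finset.mem_insert_self _ _⟩
  refine ⟨F.max' hne, F.le_max' 0 (Finset.mem_insert_self _ _), ?_, fun c hc hcI => ?_⟩
  · rw [Finset.max'_lt_iff]
    intro y hy
    rcases Finset.mem_insert.1 hy with rfl | hy
    · exact hτ
    · exact (Finset.mem_filter.1 hy).2
  · have hcF : c ∈ F :=
      Finset.mem_insert_of_mem (Finset.mem_filter.2 ⟨hC.mem_toFinset.2 hc, hcI.2⟩)
    exact (not_lt.2 (F.le_max' c hcF)) hcI.1

/-- Off a finite set of reals there is room to the right: there is `u > τ` with `(τ, u) ∩ C = ∅`.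
[folklore] -/
theorem exists_right_gap {C : Set ℝ} (hC : C.Finite) (τ : ℝ) :
    ∃ u, τ < u ∧ ∀ c ∈ C, c ∉ Ioo τ u := by
  classical
  set F : Finset ℝ := insert (τ + 1) (hC.toFinset.filter fun c => τ < c) with hF
  have hne : F.Nonempty := ⟨τ + 1, Finset.mem_insert_self _ _⟩
  refine ⟨F.min' hne, ?_, fun c hc hcI => ?_⟩
  · rw [Finset.lt_min'_iff]
    intro y hy
    rcases Finset.mem_insert.1 hy with rfl | hy
    · linarith
    · exact (Finset.mem_filter.1 hy).2
  · have hcF : c ∈ F :=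
      Finset.mem_insert_of_mem (Finset.mem_filter.2 ⟨hC.mem_toFinset.2 hc, hcI.1⟩)
    exact (not_lt.2 (F.min'_le c hcF)) hcI.2

/-- **Certificate uniqueness.**  Let `γ` be a hard-sphere trajectory in a geometry with continuous
translations over a Hausdorff position space, and `γ'` a curve with a finite set `C` of
jump times such that: `γ 0 = γ' 0`; `γ'` is free flight across every `[s, t] ⊆ [0, T]` with
`(s, t] ∩ C = ∅`; at times of `[0, T] ∖ C` no pair of `γ'` is at distance exactly `ε`; and at each
`c ∈ C` the curve `γ'` has a left limit `zl` with a contact pair `(i, j)` such that, IF this is the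
only contact pair of `zl`, then `γ' c = collidePair G i j zl`.  Then `γ = γ'` on `[0, T]`.
[folklore] -/
theorem eqOn_of_certificate (hG : ∀ x : X, Continuous (G.translate x))
    (hγ : IsHardSphereTrajectory G ε N γ) {C : Set ℝ} (hC : C.Finite)
    (h0 : γ 0 = γ' 0)
    (hfree : ∀ s t, 0 ≤ s → s ≤ t → t ≤ T → (∀ c ∈ C, c ∉ Ioc s t) →
      γ' t = freeFlight G (t - s) (γ' s))
    (hnc : ∀ t ∈ Icc 0 T, t ∉ C → ∀ i j, i ≠ j → ‖G.sepVec (γ' t i).1 (γ' t j).1‖ ≠ ε)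
    (hjump : ∀ c ∈ C, ∃ zl, Tendsto γ' (𝓝[<] c) (𝓝 zl) ∧ ∃ i j, i ≠ j ∧
      ‖G.sepVec (zl i).1 (zl j).1‖ = ε ∧
      ((∀ i' j', i' ≠ j' → ‖G.sepVec (zl i').1 (zl j').1‖ = ε →
          ({i', j'} : Finset (Fin N)) = {i, j}) → γ' c = collidePair G i j zl)) :
    EqOn γ γ' (Icc 0 T) := by
  classical
  by_contra hne
  obtain ⟨t₁, ht₁, hne₁⟩ : ∃ t₁, t₁ ∈ Icc 0 T ∧ γ t₁ ≠ γ' t₁ := by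
    by_contra hall
    push Not at hall
    exact hne fun t ht => hall t ht
  set S : Set ℝ := {t | t ∈ Icc 0 T ∧ γ t ≠ γ' t} with hS
  have hSne : S.Nonempty := ⟨t₁, ht₁, hne₁⟩
  have hSbdd : BddBelow S := ⟨0, fun t ht => ht.1.1⟩
  set τ := sInf S with hτdef
  have hτ0 : 0 ≤ τ := le_csInf hSne fun t ht => ht.1.1
  have hτT : τ ≤ T := (csInf_le hSbdd ⟨ht₁, hne₁⟩).trans ht₁.2
  have hagree : ∀ t, 0 ≤ t → t < τ → γ t = γ' t := fun t h1 h2 => by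
    by_contra hne'
    exact (lt_irrefl t) (h2.trans_le (csInf_le hSbdd ⟨⟨h1, h2.le.trans hτT⟩, hne'⟩))
  -- continuity of free flight in time
  have hffc : ∀ (z : Config N d X) (s : ℝ), Continuous fun t : ℝ => freeFlight G (t - s) z := by
    intro z s
    have hff := continuous_freeFlight_of_continuous_translate hG z
    fun_prop
  -- no contact pair of `γ'` off `C` means: not a collision time of any curve with these positions
  have hnc' : ∀ t ∈ Icc 0 T, t ∉ C → ∀ (w : Config N d X), (∀ k, (w k).1 = (γ' t k).1) →
      ∀ i j, i ≠ j → w ∉ contactSet G N ε i j := by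
    intro t ht htC w hw i j hij hc
    have := (mem_contactSet.1 hc).2
    rw [hw i, hw j] at this
    exact hnc t ht htC i j hij this
  -- Step A: agreement at `τ`
  have hA : γ τ = γ' τ := by
    rcases hτ0.eq_or_lt with heq | hlt
    · rw [← heq]; exact h0
    have hev : γ =ᶠ[𝓝[<] τ] γ' := by
      filter_upwards [Ioo_mem_nhdsLT hlt] with t ht
      exact hagree t ht.1.le ht.2
    have hposγ : ∀ k, Tendsto (fun t => (γ t k).1) (𝓝[<] τ) (𝓝 (γ τ k).1) := fun k =>
      ((hγ.pos_continuous k).tendsto τ).mono_left nhdsWithin_le_nhds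
    by_cases hτC : τ ∈ C
    · -- a jump time of the certificate
      obtain ⟨zl, hzl, i, j, hij, hcontact, himp⟩ := hjump τ hτC
      have hpos : ∀ k, (γ τ k).1 = (zl k).1 := by
        intro k
        have hev' : Continuous fun z : Config N d X => (z k).1 := by fun_prop
        have h2 : Tendsto (fun t => (γ' t k).1) (𝓝[<] τ) (𝓝 (zl k).1) :=
          (hev'.tendsto _).comp hzl
        have heq : (fun t => (γ t k).1) =ᶠ[𝓝[<] τ] fun t => (γ' t k).1 := by
          filter_upwards [hev] with t ht
          rw [ht]
        exact tendsto_nhds_unique ((hposγ k).congr' heq) h2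
      have hct : γ τ ∈ contactSet G N ε i j := by
        refine mem_contactSet.2 ⟨hγ.mem τ, ?_⟩
        rw [hpos i, hpos j]
        exact hcontact
      obtain ⟨huniq, zl', hzl', -, hγτ⟩ := hγ.binary τ i j hij hct
      have huniq' : ∀ i' j', i' ≠ j' → ‖G.sepVec (zl i').1 (zl j').1‖ = ε →
          ({i', j'} : Finset (Fin N)) = {i, j} := by
        intro i' j' hij' hc'
        refine huniq i' j' hij' (mem_contactSet.2 ⟨hγ.mem τ, ?_⟩)
        rw [hpos i', hpos j']
        exact hc'
      have hzz : zl' = zl := tendsto_nhds_unique (hzl'.congr' hev) hzl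
      rw [hγτ, himp huniq', hzz]
    · -- not a jump time: both are the same free flight from a slightly earlier time
      obtain ⟨s, hs0, hsτ, hsC⟩ := exists_left_gap hC hlt
      have hsC' : ∀ c ∈ C, c ∉ Ioc s τ := by
        intro c hc hcI
        rcases hcI.2.eq_or_lt with h | h
        · exact hτC (h ▸ hc)
        · exact hsC c hc ⟨hcI.1, h⟩
      have hγ's : ∀ t, s ≤ t → t ≤ τ → γ' t = freeFlight G (t - s) (γ' s) := fun t h1 h2 =>
        hfree s t hs0 h1 (h2.trans hτT) fun c hc hcI => hsC' c hc ⟨hcI.1, hcI.2.trans h2⟩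
      -- positions of `γ` at `τ` are those of the free flight, hence of `γ' τ`
      have hposff : ∀ k, (γ τ k).1 = (γ' τ k).1 := by
        intro k
        have hev' : Continuous fun z : Config N d X => (z k).1 := by fun_prop
        have h2 : Tendsto (fun t => (freeFlight G (t - s) (γ' s) k).1) (𝓝[<] τ)
            (𝓝 (freeFlight G (τ - s) (γ' s) k).1) :=
          ((hev'.comp (hffc (γ' s) s)).tendsto τ).mono_left nhdsWithin_le_nhds
        have heq : (fun t => (γ t k).1) =ᶠ[𝓝[<] τ] fun t => (freeFlight G (t - s) (γ' s) k).1 := by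
          filter_upwards [Ioo_mem_nhdsLT hsτ] with t ht
          rw [hagree t (hs0.trans ht.1.le) ht.2, hγ's t ht.1.le ht.2.le]
        rw [hγ's τ hsτ.le le_rfl]
        exact tendsto_nhds_unique ((hposγ k).congr' heq) h2
      have hfreeγ : ∀ u ∈ Ioc s τ, u ∉ collisionTimes G ε γ := by
        intro u hu hcol
        obtain ⟨i, j, hij, hc⟩ := mem_collisionTimes.1 hcol
        have hu0 : 0 ≤ u := hs0.trans hu.1.le
        rcases hu.2.eq_or_lt with h | h
        · subst h
          exact hnc' _ ⟨hu0, hτT⟩ hτC (γ _) hposff i j hij hc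
        · have huC : u ∉ C := fun huC => hsC u huC ⟨hu.1, h⟩
          rw [hagree u hu0 h] at hc
          exact hnc' u ⟨hu0, h.le.trans hτT⟩ huC (γ' u) (fun _ => rfl) i j hij hc
      rw [hγ.free s τ hsτ.le hfreeγ, hγ's τ hsτ.le le_rfl, hagree s hs0 hsτ]
  -- Step B: agreement on a right neighbourhood of `τ`
  obtain ⟨η, hη, hB⟩ : ∃ η > 0, ∀ t, τ < t → t < τ + η → t ≤ T → γ t = γ' t := by
    obtain ⟨u, hτu, hfreeγ⟩ := hγ.exists_Ioo_right_free τ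
    obtain ⟨u', hτu', hCfree⟩ := exists_right_gap hC τ
    refine ⟨min (u - τ) (u' - τ), lt_min (sub_pos.2 hτu) (sub_pos.2 hτu'), fun t h1 h2 h3 => ?_⟩
    have htu : t < u := by
      have := min_le_left (u - τ) (u' - τ); linarith
    have htu' : t < u' := by
      have := min_le_right (u - τ) (u' - τ); linarith
    have h1' : γ t = freeFlight G (t - τ) (γ τ) :=
      hγ.free τ t h1.le fun v hv => hfreeγ v ⟨hv.1, hv.2.trans_lt htu⟩
    have h2' : γ' t = freeFlight G (t - τ) (γ' τ) :=
      hfree τ t hτ0 h1.le h3 fun c hc hcI => hCfree c hc ⟨hcI.1, hcI.2.trans_lt htu'⟩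
    rw [h1', h2', hA]
  -- Step C: `τ + η` is a lower bound of the disagreement set, contradiction
  have hle : τ + η ≤ τ := by
    refine le_csInf hSne fun t ht => ?_
    by_contra hlt
    push Not at hlt
    have hτt : τ ≤ t := csInf_le hSbdd ht
    rcases hτt.eq_or_lt with heq | hlt'
    · exact ht.2 (heq ▸ hA)
    · exact ht.2 (hB t hlt' hlt ht.1.2)
  linarith

end Certificate

end EquilibriumClampedCollisionalWindowLDNegative

end Summit.AtomisticToContinuum.HydrodynamicLimit.Theorems

end
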